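import Summits.Ventures.PackingBounds.Configurations.LeechGolay

/-!
# The `196560` minimal vectors of the Leech lattice: norms and pairwise inner products

Framing: lottery ticket; floor = certified bounds/negative ranges. Venture `PackingBounds` (cell
`pub-packcert`, seat `pub-packcert-energy`), attained side of `κ(24) = 196560`.

In the scaling `√8 · Λ₂₄` the minimal vectors of the Leech lattice are the integer vectors of norm `32`
of the three classical shapes [Conway–Sloane, Ch. 4 §11, (135)]:
* `avec k l a b = (±4) e_k + (±4) e_l` (`k < l`; `2² · C(24,2) = 1104` vectors),
* `bvec o v`: `±2` on the `8` coordinates of the octad `o`, `0` elsewhere, with an even number of minus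
  signs (`7` free sign bits `v < 128`, the eighth is the parity bit; `759 · 2⁷ = 97152` vectors),
* `cvec i u`: `∓3` at coordinate `i` and `±1` elsewhere, the signs being those of the Golay codeword
  `cw u` (`24 · 2¹² = 98304` vectors).

This file proves, from the kernel-checked facts of `LeechGolay` (weights `0` or `≥ 8`, octads meet in
`≤ 4` points, self-orthogonality): every such vector `x` has `ip x x = 32`, and two **distinct** such
vectors have `ip x y ≤ 16` (nine shape combinations; `ip` = integer inner product). After scaling by
`1/√32` these are unit vectors with pairwise inner products `≤ 1/2` (`Configurations/Leech.lean`).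

## References
* J. H. Conway, N. J. A. Sloane, *Sphere Packings, Lattices and Groups*, Ch. 4 §11. [`ConwaySloane1999`]
-/

namespace Summit.Ventures.PackingBounds.Config.Leech

open Finset Golay

/-! ### Signs and the integer inner product -/

/-- The sign attached to a bit: `+1` for `false`, `-1` for `true`. -/
def sgn (b : Bool) : ℤ := bif b then -1 else 1

/-- `sgn true = -1`. -/
@[simp] theorem sgn_true : sgn true = -1 := rfl

/-- `sgn false = 1`. -/
@[simp] theorem sgn_false : sgn false = 1 := rfl

/-- `sgn a · sgn b = sgn (a ⊕ b)`. -/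
theorem sgn_mul_sgn (a b : Bool) : sgn a * sgn b = sgn (a ^^ b) := by
  cases a <;> cases b <;> rfl

/-- A sign is `1` or `-1`. -/
theorem sgn_cases (a : Bool) : sgn a = 1 ∨ sgn a = -1 := by
  cases a <;> simp

/-- `sgn` is injective. -/
theorem sgn_injective : Function.Injective sgn := by
  intro a b h; cases a <;> cases b <;> simp_all

/-- `sgn b = 1 - 2·[b]`. -/
theorem sgn_eq (b : Bool) : sgn b = 1 - 2 * (if b = true then 1 else 0) := by
  cases b <;> simp

/-- Sum of signs = number of terms minus twice the number of minus signs. -/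
theorem sum_sgn {ι : Type*} [Fintype ι] (f : ι → Bool) :
    ∑ i, sgn (f i) = (Fintype.card ι : ℤ) - 2 * ((univ.filter fun i => f i = true).card : ℤ) := by
  simp only [sgn_eq, Finset.sum_sub_distrib, Finset.sum_const, Finset.card_univ, nsmul_eq_mul, mul_one,
    ← Finset.mul_sum]
  rw [Finset.natCast_card_filter]

/-- `#{f ⊕ g} + 2 #{f ∧ g} = #{f} + #{g}` for indicator counts. -/
theorem card_filter_xor_add {ι : Type*} [Fintype ι] (f g : ι → Bool) :
    (univ.filter fun i => (f i ^^ g i) = true).card + 2 * (univ.filter fun i => (f i && g i) = true).card =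
      (univ.filter fun i => f i = true).card + (univ.filter fun i => g i = true).card := by
  rw [Finset.card_filter, Finset.card_filter, Finset.card_filter, Finset.card_filter, Finset.mul_sum,
    ← Finset.sum_add_distrib, ← Finset.sum_add_distrib]
  refine Finset.sum_congr rfl fun i _ => ?_
  cases f i <;> cases g i <;> rfl

/-- Parity of a pointwise `XOR` of two even indicator counts. -/
theorem even_card_filter_xor {ι : Type*} [Fintype ι] {f g : ι → Bool}
    (hf : Even (univ.filter fun i => f i = true).card) (hg : Even (univ.filter fun i => g i = true).card) :
    Even (univ.filter fun i => (f i ^^ g i) = true).card := by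
  have h := card_filter_xor_add f g
  obtain ⟨a, ha⟩ := hf; obtain ⟨b, hb⟩ := hg
  exact ⟨a + b - (univ.filter fun i => (f i && g i) = true).card, by omega⟩

/-- The integer inner product on `ℤ²⁴`. -/
def ip (x y : Fin 24 → ℤ) : ℤ := ∑ j, x j * y j

/-- `ip` is symmetric. -/
theorem ip_comm (x y : Fin 24 → ℤ) : ip x y = ip y x := by
  unfold ip; exact Finset.sum_congr rfl fun j _ => mul_comm _ _

/-- Sum of the signs of a `24`-bit mask. -/
theorem sum_sgn_testBit (m : ℕ) : ∑ j : Fin 24, sgn (m.testBit j.val) = 24 - 2 * (wt m : ℤ) := by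
  rw [sum_sgn]; simp [wt, supp]

/-! ### Shape `A`: `(±4, ±4, 0²²)` -/

/-- Shape-`A` vector `(±4) e_k + (±4) e_l`. [cite: ConwaySloane1999, Ch. 4 §11 (135)] -/
def avec (k l : Fin 24) (a b : Bool) : Fin 24 → ℤ :=
  fun j => (if j = k then 4 * sgn a else 0) + (if j = l then 4 * sgn b else 0)

/-- Testing a vector against a shape-`A` vector. -/
theorem ip_avec (x : Fin 24 → ℤ) (k l : Fin 24) (a b : Bool) :
    ip x (avec k l a b) = 4 * sgn a * x k + 4 * sgn b * x l := by
  simp only [ip, avec, mul_add, Finset.sum_add_distrib, mul_ite, mul_zero, Finset.sum_ite_eq', Finset.mem_univ,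
    if_true]
  ring

/-- Norm of a shape-`A` vector (`k ≠ l`). -/
theorem ip_avec_self {k l : Fin 24} (hkl : k < l) (a b : Bool) : ip (avec k l a b) (avec k l a b) = 32 := by
  rw [ip_avec]
  have hne : k ≠ l := ne_of_lt hkl
  simp only [avec, if_true, if_neg hne, if_neg (Ne.symm hne), add_zero, zero_add]
  rcases sgn_cases a with ha | ha <;> rcases sgn_cases b with hb | hb <;> rw [ha, hb] <;> norm_num

/-- Two distinct shape-`A` vectors have inner product `≤ 16`. -/
theorem ip_avec_avec_le {k l k' l' : Fin 24} (hkl : k < l) (hkl' : k' < l') {a b a' b' : Bool}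
    (hne : avec k l a b ≠ avec k' l' a' b') : ip (avec k l a b) (avec k' l' a' b') ≤ 16 := by
  have hidx : ¬ (k = k' ∧ l = l' ∧ a = a' ∧ b = b') := by
    rintro ⟨rfl, rfl, rfl, rfl⟩; exact hne rfl
  rw [ip_avec]
  simp only [avec]
  rcases sgn_cases a with ha | ha <;> rcases sgn_cases b with hb | hb <;>
    rcases sgn_cases a' with ha' | ha' <;> rcases sgn_cases b' with hb' | hb' <;>
    simp only [ha, hb, ha', hb'] <;> split_ifs <;> (try omega) <;>
    (exfalso; apply hidx; refine ⟨by omega, by omega, ?_, ?_⟩ <;> apply sgn_injective <;> omega)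

/-! ### Shape `C`: `(∓3, ±1²³)` with Golay signs -/

/-- Shape-`C` vector: signs of the codeword `cw u`, coordinate `i` multiplied by `-3`.
[cite: ConwaySloane1999, Ch. 4 §11 (135)] -/
def cvec (i : Fin 24) (u : ℕ) : Fin 24 → ℤ :=
  fun j => sgn ((cw u).testBit j.val) * (if j = i then -3 else 1)

/-- `Σ_j g_j · (1 - 4 δ_{ji}) = Σ_j g_j - 4 g_i`. -/
theorem sum_mul_tripler (g : Fin 24 → ℤ) (i : Fin 24) :
    ∑ j, g j * (if j = i then -3 else 1) = (∑ j, g j) - 4 * g i := by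
  have : ∀ j, g j * (if j = i then (-3 : ℤ) else 1) = g j - (if j = i then 4 * g j else 0) := by
    intro j; split_ifs <;> ring
  simp only [this, Finset.sum_sub_distrib, Finset.sum_ite_eq', Finset.mem_univ, if_true]

/-- Testing a vector against a shape-`C` vector. -/
theorem ip_cvec (x : Fin 24 → ℤ) (i : Fin 24) (u : ℕ) :
    ip x (cvec i u) = (∑ j, x j * sgn ((cw u).testBit j.val)) - 4 * (x i * sgn ((cw u).testBit i.val)) := by
  unfold ip cvec
  calc ∑ j, x j * (sgn ((cw u).testBit j.val) * (if j = i then -3 else 1))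
      = ∑ j, (x j * sgn ((cw u).testBit j.val)) * (if j = i then -3 else 1) :=
        Finset.sum_congr rfl fun j _ => by ring
    _ = (∑ j, x j * sgn ((cw u).testBit j.val)) - 4 * (x i * sgn ((cw u).testBit i.val)) :=
        sum_mul_tripler (fun j => x j * sgn ((cw u).testBit j.val)) i

/-- The inner product of two shape-`C` vectors in terms of the codeword `d = cw (u ⊕ u')`. -/
theorem ip_cvec_cvec (i i' : Fin 24) (u u' : ℕ) :
    ip (cvec i u) (cvec i' u') =
      (24 - 2 * (wt (cw (u ^^^ u')) : ℤ)) - 4 * sgn ((cw (u ^^^ u')).testBit i.val)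
        + (if i' = i then 12 else -4) * sgn ((cw (u ^^^ u')).testBit i'.val) := by
  rw [ip_cvec]
  have hd : ∀ j : Fin 24, sgn ((cw u).testBit j.val) * sgn ((cw u').testBit j.val) =
      sgn ((cw (u ^^^ u')).testBit j.val) := by
    intro j; rw [sgn_mul_sgn, cw_xor, Nat.testBit_xor]
  have h1 : ∑ j, cvec i u j * sgn ((cw u').testBit j.val) =
      (24 - 2 * (wt (cw (u ^^^ u')) : ℤ)) - 4 * sgn ((cw (u ^^^ u')).testBit i.val) := by
    have : ∀ j, cvec i u j * sgn ((cw u').testBit j.val) =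
        sgn ((cw (u ^^^ u')).testBit j.val) * (if j = i then -3 else 1) := by
      intro j; simp only [cvec]; rw [← hd j]; ring
    simp only [this, sum_mul_tripler, sum_sgn_testBit]
  rw [h1]
  simp only [cvec]
  rw [show sgn ((cw u).testBit i'.val) * (if i' = i then (-3 : ℤ) else 1) * sgn ((cw u').testBit i'.val) =
      (if i' = i then (-3 : ℤ) else 1) * sgn ((cw (u ^^^ u')).testBit i'.val) by rw [← hd i']; ring]
  split_ifs <;> ring

/-- `wt 0 = 0`. -/
theorem wt_zero : wt 0 = 0 := by simp [wt, supp]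

/-- Norm of a shape-`C` vector. -/
theorem ip_cvec_self (i : Fin 24) (u : ℕ) : ip (cvec i u) (cvec i u) = 32 := by
  rw [ip_cvec_cvec, Nat.xor_self, cw_zero, wt_zero]
  simp

/-- Two distinct shape-`C` vectors have inner product `≤ 16` (weights `≥ 8`). -/
theorem ip_cvec_cvec_le {i i' : Fin 24} {u u' : ℕ} (hu : u < 4096) (hu' : u' < 4096)
    (hne : cvec i u ≠ cvec i' u') : ip (cvec i u) (cvec i' u') ≤ 16 := by
  rw [ip_cvec_cvec]
  by_cases huu : u = u'
  · subst huu
    have hii : i' ≠ i := fun h => hne (by rw [h])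
    rw [Nat.xor_self, cw_zero, wt_zero, if_neg hii]
    simp
  · have h8 : (8 : ℤ) ≤ wt (cw (u ^^^ u')) := by exact_mod_cast wt_cw_xor_ge hu hu' huu
    by_cases hii : i' = i
    · subst hii
      rw [if_pos rfl]
      rcases sgn_cases ((cw (u ^^^ u')).testBit i'.val) with h1 | h1 <;> rw [h1] <;> omega
    · rw [if_neg hii]
      rcases sgn_cases ((cw (u ^^^ u')).testBit i.val) with h1 | h1 <;>
        rcases sgn_cases ((cw (u ^^^ u')).testBit i'.val) with h2 | h2 <;> rw [h1, h2] <;> omega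

/-- Coordinates of a shape-`C` vector are `±1`, except `±3` at `i`. -/
theorem cvec_apply_cases (i : Fin 24) (u : ℕ) (j : Fin 24) :
    (j ≠ i ∧ (cvec i u j = 1 ∨ cvec i u j = -1)) ∨ (j = i ∧ (cvec i u j = 3 ∨ cvec i u j = -3)) := by
  unfold cvec
  rcases sgn_cases ((cw u).testBit j.val) with h | h <;> rw [h] <;> by_cases hj : j = i <;> simp [hj]

/-- A shape-`A` vector against a shape-`C` vector: inner product `≤ 16`. -/
theorem ip_avec_cvec_le {k l : Fin 24} (hkl : k < l) (a b : Bool) (i : Fin 24) (u : ℕ) :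
    ip (avec k l a b) (cvec i u) ≤ 16 := by
  rw [ip_comm, ip_avec]
  have hne : k ≠ l := ne_of_lt hkl
  rcases sgn_cases a with ha | ha <;> rcases sgn_cases b with hb | hb <;> rw [ha, hb] <;>
    rcases cvec_apply_cases i u k with ⟨hk, hk1 | hk1⟩ | ⟨hk, hk1 | hk1⟩ <;>
    rcases cvec_apply_cases i u l with ⟨hl, hl1 | hl1⟩ | ⟨hl, hl1 | hl1⟩ <;> rw [hk1, hl1] <;>
    first | (norm_num; done) | (exfalso; exact hne (hk.trans hl.symm))

/-! ### Shape `B`: `(±2⁸, 0¹⁶)` on an octad, even signs -/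

/-- Number of set bits among the `7` free sign bits. -/
def cnt7 (v : ℕ) : ℕ := (univ.filter fun t : Fin 7 => v.testBit t.val = true).card

/-- The `8` sign bits of the pattern `v < 128`: bits `0..6` of `v` and their parity as the eighth. -/
def bbit (v : ℕ) (r : Fin 8) : Bool := if r.val < 7 then v.testBit r.val else decide (cnt7 v % 2 = 1)

/-- The sign pattern has an even number of minus signs. -/
theorem even_card_bbit (v : ℕ) : Even (univ.filter fun r : Fin 8 => bbit v r = true).card := by
  rw [Finset.card_filter, Fin.sum_univ_castSucc]
  have h7 : ∑ t : Fin 7, (if bbit v t.castSucc = true then 1 else 0) = cnt7 v := by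
    rw [cnt7, Finset.card_filter]
    refine Finset.sum_congr rfl fun t _ => ?_
    simp [bbit, t.isLt]
  rw [h7]
  have hl : bbit v (Fin.last 7) = decide (cnt7 v % 2 = 1) := by simp [bbit]
  rw [hl]
  by_cases h : cnt7 v % 2 = 1
  · simp only [h, decide_true, if_true]; exact ⟨(cnt7 v + 1) / 2, by omega⟩
  · simp only [h, decide_false, Bool.false_eq_true, if_false, add_zero]; exact ⟨cnt7 v / 2, by omega⟩

/-- Patterns `v ≠ v' < 128` differ in some sign bit. -/
theorem bbit_ne_of_ne {v v' : ℕ} (hv : v < 128) (hv' : v' < 128) (h : v ≠ v') : ∃ r, bbit v r ≠ bbit v' r := by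
  by_contra hall
  simp only [ne_eq, not_exists, Decidable.not_not] at hall
  apply h
  apply Nat.eq_of_testBit_eq
  intro t
  by_cases ht : t < 7
  · have := hall ⟨t, by omega⟩
    simpa [bbit, ht] using this
  · have h128 : 2 ^ 7 ≤ 2 ^ t := Nat.pow_le_pow_right (by norm_num) (by omega)
    rw [Nat.testBit_eq_false_of_lt (lt_of_lt_of_le hv h128),
      Nat.testBit_eq_false_of_lt (lt_of_lt_of_le hv' h128)]

/-- Increasing enumeration of the octad `o` by `Fin 8`. -/
def opos (o : Fin 759) : Fin 8 ≃o (osupp o) := (osupp o).orderIsoOfFin (card_osupp o)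

/-- Shape-`B` vector on the octad `o` with sign pattern `v`. [cite: ConwaySloane1999, Ch. 4 §11 (135)] -/
def bvec (o : Fin 759) (v : ℕ) : Fin 24 → ℤ :=
  fun j => if h : j ∈ osupp o then 2 * sgn (bbit v ((opos o).symm ⟨j, h⟩)) else 0

/-- Values of a shape-`B` vector on its octad. -/
theorem bvec_apply_opos (o : Fin 759) (v : ℕ) (r : Fin 8) :
    bvec o v ((opos o r : osupp o) : Fin 24) = 2 * sgn (bbit v r) := by
  simp only [bvec, dif_pos (opos o r).2, Subtype.coe_eta, OrderIso.symm_apply_apply]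

/-- A shape-`B` vector vanishes off its octad. -/
theorem bvec_eq_zero {o : Fin 759} {v : ℕ} {j : Fin 24} (h : j ∉ osupp o) : bvec o v j = 0 := by
  simp [bvec, h]

/-- Coordinates of a shape-`B` vector are `0` or `±2`; nonzero exactly on the octad. -/
theorem bvec_apply_cases (o : Fin 759) (v : ℕ) (j : Fin 24) :
    (j ∉ osupp o ∧ bvec o v j = 0) ∨ (j ∈ osupp o ∧ (bvec o v j = 2 ∨ bvec o v j = -2)) := by
  by_cases h : j ∈ osupp o
  · right; refine ⟨h, ?_⟩
    simp only [bvec, dif_pos h]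
    rcases sgn_cases (bbit v ((opos o).symm ⟨j, h⟩)) with h1 | h1 <;> rw [h1] <;> simp
  · left; exact ⟨h, bvec_eq_zero h⟩

/-- Reindexing a sum over an octad by `Fin 8`. -/
theorem sum_osupp (o : Fin 759) (F : Fin 24 → ℤ) : ∑ j ∈ osupp o, F j = ∑ r : Fin 8, F (opos o r) := by
  rw [← Finset.sum_coe_sort]
  exact (Fintype.sum_equiv (opos o).toEquiv (fun r => F (opos o r)) (fun j => F j) fun r => rfl).symm

/-- Testing a vector against a shape-`B` vector. -/
theorem ip_bvec (x : Fin 24 → ℤ) (o : Fin 759) (v : ℕ) :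
    ip x (bvec o v) = ∑ r : Fin 8, x (opos o r) * (2 * sgn (bbit v r)) := by
  unfold ip
  rw [← Finset.sum_subset (Finset.subset_univ (osupp o)) (fun j _ hj => by rw [bvec_eq_zero hj, mul_zero]),
    sum_osupp]
  exact Finset.sum_congr rfl fun r _ => by rw [bvec_apply_opos]

/-- Norm of a shape-`B` vector. -/
theorem ip_bvec_self (o : Fin 759) (v : ℕ) : ip (bvec o v) (bvec o v) = 32 := by
  rw [ip_bvec]
  simp only [bvec_apply_opos]
  have : ∀ r : Fin 8, 2 * sgn (bbit v r) * (2 * sgn (bbit v r)) = 4 := by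
    intro r; rcases sgn_cases (bbit v r) with h | h <;> rw [h] <;> norm_num
  simp [this]

/-- Two distinct shape-`B` vectors on the same octad: inner product `≤ 16` (even sign patterns differ twice). -/
theorem ip_bvec_bvec_same_le (o : Fin 759) {v v' : ℕ} (hv : v < 128) (hv' : v' < 128)
    (hne : bvec o v ≠ bvec o v') : ip (bvec o v) (bvec o v') ≤ 16 := by
  have hvv : v ≠ v' := fun h => hne (by rw [h])
  rw [ip_bvec]
  simp only [bvec_apply_opos]
  have : ∀ r : Fin 8, 2 * sgn (bbit v r) * (2 * sgn (bbit v' r)) = 4 * sgn (bbit v r ^^ bbit v' r) := by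
    intro r; rw [← sgn_mul_sgn]; ring
  simp only [this, ← Finset.mul_sum, sum_sgn, Fintype.card_fin]
  have hev := even_card_filter_xor (even_card_bbit v) (even_card_bbit v')
  obtain ⟨r, hr⟩ := bbit_ne_of_ne hv hv' hvv
  have hpos : 0 < (univ.filter fun r : Fin 8 => (bbit v r ^^ bbit v' r) = true).card := by
    apply Finset.card_pos.mpr
    refine ⟨r, Finset.mem_filter.mpr ⟨Finset.mem_univ _, ?_⟩⟩
    cases h1 : bbit v r <;> cases h2 : bbit v' r <;> simp_all
  obtain ⟨m, hm⟩ := hev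
  push_cast
  omega

/-- Counting octad positions with a property = counting within the octad. -/
theorem card_filter_opos (o : Fin 759) (P : Fin 24 → Prop) [DecidablePred P] :
    (univ.filter fun r : Fin 8 => P (opos o r)).card = ((osupp o).filter P).card := by
  have h := sum_osupp o (fun j => if P j then 1 else 0)
  rw [Finset.card_filter, Finset.card_filter]
  exact_mod_cast h.symm

/-- Two shape-`B` vectors on distinct octads: inner product `≤ 16` (octads meet in `≤ 4` points). -/
theorem ip_bvec_bvec_ne_le {o o' : Fin 759} (hoo : o ≠ o') (v v' : ℕ) :
    ip (bvec o v) (bvec o' v') ≤ 16 := by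
  rw [ip_bvec]
  have hle : ∀ r : Fin 8, bvec o v (opos o' r) * (2 * sgn (bbit v' r)) ≤
      4 * (if ((opos o' r : osupp o') : Fin 24) ∈ osupp o then 1 else 0) := by
    intro r
    rcases bvec_apply_cases o v (opos o' r) with ⟨h0, h1⟩ | ⟨h0, h1 | h1⟩ <;>
      rcases sgn_cases (bbit v' r) with h2 | h2 <;> simp [h0, h1, h2]
  refine (Finset.sum_le_sum fun r _ => hle r).trans ?_
  rw [← Finset.mul_sum, ← Finset.natCast_card_filter, card_filter_opos o' (· ∈ osupp o),
    Finset.filter_mem_eq_inter, Finset.inter_comm]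
  have := card_osupp_inter_le hoo
  omega

/-- A shape-`B` vector against a shape-`C` vector: inner product `≤ 16` (self-orthogonality of the code). -/
theorem ip_bvec_cvec_le (o : Fin 759) (v : ℕ) (i : Fin 24) {u : ℕ} (hu : u < 4096) :
    ip (bvec o v) (cvec i u) ≤ 16 := by
  rw [ip_comm, ip_bvec]
  -- q r := combined sign on the r-th octad position
  let q : Fin 8 → Bool := fun r => (cw u).testBit ((opos o r : osupp o) : Fin 24).val ^^ bbit v r
  have hterm : ∀ r : Fin 8, cvec i u (opos o r) * (2 * sgn (bbit v r)) =
      2 * sgn (q r) - (if ((opos o r : osupp o) : Fin 24) = i then 8 * sgn (q r) else 0) := by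
    intro r
    simp only [cvec, q, ← sgn_mul_sgn]
    split_ifs <;> ring
  simp only [hterm, Finset.sum_sub_distrib, ← Finset.mul_sum, sum_sgn, Fintype.card_fin]
  -- parity of the number of minus signs among the q r
  have hf : Even (univ.filter fun r : Fin 8 =>
      (cw u).testBit ((opos o r : osupp o) : Fin 24).val = true).card := by
    rw [card_filter_opos o (fun j : Fin 24 => (cw u).testBit j.val = true)]
    have h2 := even_card_supp_inter_osupp hu o
    have h3 : supp (cw u) ∩ osupp o = (osupp o).filter fun j => (cw u).testBit j.val = true := by
      ext j; simp [supp, and_comm]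
    rwa [h3] at h2
  have hev : Even (univ.filter fun r : Fin 8 => q r = true).card := even_card_filter_xor hf (even_card_bbit v)
  obtain ⟨m, hm⟩ := hev
  by_cases hi : i ∈ osupp o
  · -- i is the r₀-th octad position
    set r₀ := (opos o).symm ⟨i, hi⟩ with hr₀
    have hsum : ∑ r : Fin 8, (if ((opos o r : osupp o) : Fin 24) = i then 8 * sgn (q r) else 0) = 8 * sgn (q r₀) := by
      rw [Finset.sum_eq_single r₀]
      · rw [if_pos]; rw [hr₀, OrderIso.apply_symm_apply]
      · intro r _ hr
        rw [if_neg]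
        intro h
        apply hr
        apply (opos o).injective
        exact Subtype.ext (by rw [h, hr₀, OrderIso.apply_symm_apply])
      · simp
    rw [hsum]
    rcases sgn_cases (q r₀) with h1 | h1
    · rw [h1]; push_cast; omega
    · -- q r₀ is a minus sign, so there are at least two
      have hmem : r₀ ∈ univ.filter fun r : Fin 8 => q r = true := by
        refine Finset.mem_filter.mpr ⟨Finset.mem_univ _, ?_⟩
        cases h : q r₀ <;> simp_all
      have hpos := Finset.card_pos.mpr ⟨r₀, hmem⟩
      rw [h1]; push_cast; omega
  · have hsum : ∑ r : Fin 8, (if ((opos o r : osupp o) : Fin 24) = i then 8 * sgn (q r) else 0) = 0 := by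
      refine Finset.sum_eq_zero fun r _ => ?_
      rw [if_neg]
      intro h; exact hi (h ▸ (opos o r).2)
    rw [hsum]; push_cast; omega

/-- A shape-`A` vector against a shape-`B` vector: inner product `≤ 16`. -/
theorem ip_avec_bvec_le {k l : Fin 24} (hkl : k < l) (a b : Bool) (o : Fin 759) (v : ℕ) :
    ip (avec k l a b) (bvec o v) ≤ 16 := by
  rw [ip_comm, ip_avec]
  have _ := hkl
  rcases sgn_cases a with ha | ha <;> rcases sgn_cases b with hb | hb <;> rw [ha, hb] <;>
    rcases bvec_apply_cases o v k with ⟨_, hk1⟩ | ⟨_, hk1 | hk1⟩ <;>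
    rcases bvec_apply_cases o v l with ⟨_, hl1⟩ | ⟨_, hl1 | hl1⟩ <;> rw [hk1, hl1] <;> norm_num

end Summit.Ventures.PackingBounds.Config.Leech
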